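import Summits.AtomisticToContinuum.Crystallization.Theorems.OverbindingBudgetAffineFarStraighteningHook
import Summits.AtomisticToContinuum.Crystallization.Theorems.OverbindingBudgetAffineFarDevelopmentOrder

/-!
# D-C (cap) · THE CAP STAR AND THE SECOND-SHELL HOOK IN THE DEPTH FORM — lens-4 g59 (DEV brick for `RaffDevelopment`)

`Summit.AtomisticToContinuum.Crystallization`, family `OverbindingBudgetAffineFarSmoothSplit`; memo NODE-g59-DevSpec §3 L6.
Setting of the Order brick: site `n`, `Y = y n − y i` with `s ≤ ‖Y‖` (`s = nn_n`), near-conformal frame `A` (`‖A v − Q v‖ ≤ τ‖v‖`,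
`τ ≤ 1/20`), depth `X(v) := −⟪Y, A v⟫ = ⟪−A† Y, v⟫`.  The parent label `w` is deep (`(1 − τ)‖Y‖ ≤ √2·X(w)`, Order `exists_deep_label`).

* §1 `depth_of_developed_first` / `depth_of_developed_second`: a label whose site is not farther from the centre than `n` has depth
  `X ≥ (9/20)·s` (unit label) resp. `X ≥ (9/10)·s` (second shell), for fuzz `(2‖Y‖ + 3s)·δ₀ ≤ s²/400`;
* §2 `capStar_first` (CAPS `exists_twoStep_of_twoShell` on `d := −A† Y`): a developed unit label `u ≠ w` is adjacent to the parent label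
  `w` or both are adjacent to a unit `c ∈ P` of depth `X(c) ≥ (14/25)·s`;
* §3 `capHook_second` (HOOK `exists_hook_of_twoShell` + `hook_level`): a developed second-shell label `w₂` is adjacent to a unit `c ∈ P` of
  depth `X(c) ≥ (14/25)·s`;
* §4 `nearer_of_capDepth`: a unit label of depth `≥ (14/25)·s` points to a site STRICTLY nearer to the centre (fuzz `≤ s²/100`), hence to a
  developed one.  Margins: `2·(14/25) = 1.12 > (21/20)² + 1/100 = 1.1125`.
-/

namespace Summit.AtomisticToContinuum.Crystallization.Theorems.OverbindingBudgetAffineFarSmoothSplit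

open Literature.Geometry.DiscreteGeometry (fccTwoShellPattern hcpTwoShellPattern)
open scoped RealInnerProductSpace

/-! ## §1  Depth of developed labels -/

/-- Near-conformal frames are bounded below: `(1 − τ)‖v‖ ≤ ‖A v‖`. [this file] -/
theorem norm_frame_ge {A : EuclideanSpace ℝ (Fin 3) →ₗ[ℝ] EuclideanSpace ℝ (Fin 3)} {Q : EuclideanSpace ℝ (Fin 3) →ₗᵢ[ℝ] EuclideanSpace ℝ (Fin 3)}
    {τ : ℝ} (hA : ∀ v, ‖A v - Q v‖ ≤ τ * ‖v‖) (v : EuclideanSpace ℝ (Fin 3)) : (1 - τ) * ‖v‖ ≤ ‖A v‖ := by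
  have h : ‖Q v‖ ≤ ‖A v‖ + ‖A v - Q v‖ := by
    calc ‖Q v‖ = ‖A v - (A v - Q v)‖ := by rw [sub_sub_cancel]
      _ ≤ ‖A v‖ + ‖A v - Q v‖ := norm_sub_le _ _
  rw [LinearIsometry.norm_map] at h
  linarith [hA v]

/-- Near-conformal frames are bounded above: `‖A v‖ ≤ (1 + τ)‖v‖`. [this file] -/
theorem norm_frame_le {A : EuclideanSpace ℝ (Fin 3) →ₗ[ℝ] EuclideanSpace ℝ (Fin 3)} {Q : EuclideanSpace ℝ (Fin 3) →ₗᵢ[ℝ] EuclideanSpace ℝ (Fin 3)}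
    {τ : ℝ} (hA : ∀ v, ‖A v - Q v‖ ≤ τ * ‖v‖) (v : EuclideanSpace ℝ (Fin 3)) : ‖A v‖ ≤ (1 + τ) * ‖v‖ := by
  calc ‖A v‖ = ‖Q v + (A v - Q v)‖ := by rw [add_sub_cancel]
    _ ≤ ‖Q v‖ + ‖A v - Q v‖ := norm_add_le _ _
    _ ≤ ‖v‖ + τ * ‖v‖ := by rw [LinearIsometry.norm_map]; exact add_le_add le_rfl (hA v)
    _ = (1 + τ) * ‖v‖ := by ring

/-- A developed UNIT label (its site `z` is not farther from the centre than `n`) has depth `X(u) ≥ (9/20)·s`. [this file; Order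
`deep_of_notFarther`] -/
theorem depth_of_developed_first {A : EuclideanSpace ℝ (Fin 3) →ₗ[ℝ] EuclideanSpace ℝ (Fin 3)}
    {Q : EuclideanSpace ℝ (Fin 3) →ₗᵢ[ℝ] EuclideanSpace ℝ (Fin 3)} {τ s δ₀ : ℝ} {Y u z : EuclideanSpace ℝ (Fin 3)}
    (hτ : τ ≤ 1 / 20) (hA : ∀ v, ‖A v - Q v‖ ≤ τ * ‖v‖) (hs : 0 < s) (hu1 : ‖u‖ = 1) (hδ : 0 ≤ δ₀) (hz : ‖z - (Y + s • A u)‖ ≤ δ₀)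
    (hle : ‖z‖ ≤ ‖Y‖) (hfz : (2 * ‖Y‖ + 3 * s) * δ₀ ≤ s ^ 2 / 400) : (9 / 20) * s ≤ -⟪Y, A u⟫ := by
  have h := deep_of_notFarther hz hle
  have hlo : s * (19 / 20) ≤ ‖s • A u‖ := by
    rw [norm_smul, Real.norm_of_nonneg hs.le]
    refine mul_le_mul_of_nonneg_left ?_ hs.le
    have := norm_frame_ge hA u; rw [hu1] at this; linarith
  have hlo2 : (s * (19 / 20)) ^ 2 ≤ ‖s • A u‖ ^ 2 := pow_le_pow_left₀ (by positivity) hlo 2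
  have hup : ‖s • A u‖ ≤ s * (21 / 20) := by
    rw [norm_smul, Real.norm_of_nonneg hs.le]
    refine mul_le_mul_of_nonneg_left ?_ hs.le
    have := norm_frame_le hA u; rw [hu1] at this; linarith
  have hfuzz : (2 * ‖Y + s • A u‖ + δ₀) * δ₀ ≤ (2 * ‖Y‖ + 3 * s) * δ₀ := by
    apply mul_le_mul_of_nonneg_right _ hδ
    have hYw : ‖Y + s • A u‖ ≤ ‖Y‖ + s * (21 / 20) := (norm_add_le _ _).trans (add_le_add le_rfl hup)
    have : δ₀ ≤ s / 2 := by nlinarith [norm_nonneg Y]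
    linarith
  have hin : ⟪Y, s • A u⟫ = s * ⟪Y, A u⟫ := by rw [inner_smul_right]
  rw [hin] at h
  have key : s * (2 * ((9 / 20) * s)) ≤ s * (2 * (-⟪Y, A u⟫)) := by nlinarith
  have := le_of_mul_le_mul_left key hs
  linarith

/-- A developed SECOND-SHELL label has depth `X(w) ≥ (9/10)·s`. [this file; Order `deep_of_notFarther`] -/
theorem depth_of_developed_second {A : EuclideanSpace ℝ (Fin 3) →ₗ[ℝ] EuclideanSpace ℝ (Fin 3)}
    {Q : EuclideanSpace ℝ (Fin 3) →ₗᵢ[ℝ] EuclideanSpace ℝ (Fin 3)} {τ s δ₀ : ℝ} {Y w z : EuclideanSpace ℝ (Fin 3)}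
    (hτ : τ ≤ 1 / 20) (hA : ∀ v, ‖A v - Q v‖ ≤ τ * ‖v‖) (hs : 0 < s) (hw2 : ‖w‖ ^ 2 = 2) (hδ : 0 ≤ δ₀) (hz : ‖z - (Y + s • A w)‖ ≤ δ₀)
    (hle : ‖z‖ ≤ ‖Y‖) (hfz : (2 * ‖Y‖ + 3 * s) * δ₀ ≤ s ^ 2 / 400) : (9 / 10) * s ≤ -⟪Y, A w⟫ := by
  have h := deep_of_notFarther hz hle
  have hwn : ‖w‖ ≤ 3 / 2 := by nlinarith [norm_nonneg w]
  have hwn' : 0 ≤ ‖w‖ := norm_nonneg w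
  have hlo : s * ((19 / 20) * ‖w‖) ≤ ‖s • A w‖ := by
    rw [norm_smul, Real.norm_of_nonneg hs.le]
    refine mul_le_mul_of_nonneg_left ?_ hs.le
    have := norm_frame_ge hA w; nlinarith
  have hlo2 : (s * ((19 / 20) * ‖w‖)) ^ 2 ≤ ‖s • A w‖ ^ 2 := pow_le_pow_left₀ (by positivity) hlo 2
  have hup : ‖s • A w‖ ≤ s * ((21 / 20) * ‖w‖) := by
    rw [norm_smul, Real.norm_of_nonneg hs.le]
    refine mul_le_mul_of_nonneg_left ?_ hs.le
    have := norm_frame_le hA w; nlinarith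
  have hfuzz : (2 * ‖Y + s • A w‖ + δ₀) * δ₀ ≤ (2 * ‖Y‖ + 4 * s) * δ₀ := by
    apply mul_le_mul_of_nonneg_right _ hδ
    have hYw : ‖Y + s • A w‖ ≤ ‖Y‖ + s * ((21 / 20) * ‖w‖) := (norm_add_le _ _).trans (add_le_add le_rfl hup)
    have : δ₀ ≤ s / 2 := by nlinarith [norm_nonneg Y]
    nlinarith
  have hfz' : (2 * ‖Y‖ + 4 * s) * δ₀ ≤ s ^ 2 / 200 := by
    have : s * δ₀ ≤ s ^ 2 / 400 := by nlinarith [norm_nonneg Y]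
    nlinarith
  have hin : ⟪Y, s • A w⟫ = s * ⟪Y, A w⟫ := by rw [inner_smul_right]
  rw [hin] at h
  have hsq : (s * ((19 / 20) * ‖w‖)) ^ 2 = s ^ 2 * (361 / 400) * ‖w‖ ^ 2 := by ring
  rw [hsq, hw2] at hlo2
  have key : s * (2 * ((9 / 10) * s)) ≤ s * (2 * (-⟪Y, A w⟫)) := by nlinarith
  have := le_of_mul_le_mul_left key hs
  linarith

/-! ## §2  The first-shell cap star -/

/-- **CAP STAR** (first shell): a developed unit label `u ≠ w` (depth `≥ (9/20)s`) and the deep parent label `w` are adjacent, or have a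
common pattern neighbour `c` (unit, adjacent to both) of depth `X(c) ≥ (14/25)·s`. [this file; CAPS `exists_twoStep_of_twoShell`] -/
theorem capStar_first {P : Finset (EuclideanSpace ℝ (Fin 3))} (hP : P = fccTwoShellPattern ∨ P = hcpTwoShellPattern)
    {A : EuclideanSpace ℝ (Fin 3) →ₗ[ℝ] EuclideanSpace ℝ (Fin 3)} {Q : EuclideanSpace ℝ (Fin 3) →ₗᵢ[ℝ] EuclideanSpace ℝ (Fin 3)}
    {τ s : ℝ} {Y u w : EuclideanSpace ℝ (Fin 3)} (hτ0 : 0 ≤ τ) (hτ : τ ≤ 1 / 20) (hA : ∀ v, ‖A v - Q v‖ ≤ τ * ‖v‖) (hs : 0 < s)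
    (hsY : s ≤ ‖Y‖) (hu : u ∈ P) (hu1 : ‖u‖ = 1) (hw : w ∈ P) (hw1 : ‖w‖ = 1) (hne : u ≠ w)
    (hwd : (1 - τ) * ‖Y‖ ≤ Real.sqrt 2 * (-⟪Y, A w⟫)) (hud : (9 / 20) * s ≤ -⟪Y, A u⟫) :
    dist u w = 1 ∨ ∃ c ∈ P, ‖c‖ = 1 ∧ dist c u = 1 ∧ dist c w = 1 ∧ (14 / 25) * s ≤ -⟪Y, A c⟫ := by
  by_cases hadj : dist u w = 1
  · exact Or.inl hadj
  right
  set d : EuclideanSpace ℝ (Fin 3) := -(LinearMap.adjoint A Y) with hd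
  have hdu : ⟪d, u⟫ = -⟪Y, A u⟫ := inner_depthForm A Y u
  have hdw : ⟪d, w⟫ = -⟪Y, A w⟫ := inner_depthForm A Y w
  have hdn : ‖d‖ ≤ (1 + τ) * ‖Y‖ := by rw [hd, norm_neg]; exact norm_adjoint_le hτ0 hA Y
  -- `X(w) ≥ 0.67 s` and `‖d‖ < √3 (X u + X w)`
  have hXw0 : 0 ≤ -⟪Y, A w⟫ := by
    have h0 : 0 ≤ (1 - τ) * ‖Y‖ := mul_nonneg (by linarith) (norm_nonneg _)
    nlinarith [Real.sqrt_nonneg 2]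
  have hX : (19 / 20) * ‖Y‖ ≤ Real.sqrt 2 * (-⟪Y, A w⟫) := by nlinarith [norm_nonneg Y]
  have hX2 : ((19 / 20) * ‖Y‖) ^ 2 ≤ 2 * (-⟪Y, A w⟫) ^ 2 := by
    have h := pow_le_pow_left₀ (by positivity) hX 2
    have h2 : (Real.sqrt 2 * (-⟪Y, A w⟫)) ^ 2 = 2 * (-⟪Y, A w⟫) ^ 2 := by
      rw [mul_pow, Real.sq_sqrt (by norm_num : (0:ℝ) ≤ 2)]
    rw [h2] at h
    exact h
  have hXws : (67 / 100) * s ≤ -⟪Y, A w⟫ := by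
    by_contra h
    have h2 := pow_le_pow_left₀ hXw0 (not_le.mp h).le 2
    have hY2 : s ^ 2 ≤ ‖Y‖ ^ 2 := pow_le_pow_left₀ hs.le hsY 2
    nlinarith
  have hlt : ‖d‖ < Real.sqrt 3 * (⟪d, u⟫ + ⟪d, w⟫) := by
    rw [hdu, hdw]
    have h3 : ((21 / 20) * ‖Y‖) ^ 2 < (Real.sqrt 3 * (-⟪Y, A w⟫)) ^ 2 := by
      have h3' : (Real.sqrt 3 * (-⟪Y, A w⟫)) ^ 2 = 3 * (-⟪Y, A w⟫) ^ 2 := by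
        rw [mul_pow, Real.sq_sqrt (by norm_num : (0:ℝ) ≤ 3)]
      rw [h3']
      have hYpos : 0 < ‖Y‖ := lt_of_lt_of_le hs hsY
      nlinarith
    have h4 : (21 / 20) * ‖Y‖ < Real.sqrt 3 * (-⟪Y, A w⟫) :=
      lt_of_pow_lt_pow_left₀ 2 (mul_nonneg (Real.sqrt_nonneg 3) hXw0) h3
    have h5 : 0 ≤ Real.sqrt 3 * (-⟪Y, A u⟫) := mul_nonneg (Real.sqrt_nonneg 3) (by linarith)
    nlinarith
  obtain ⟨c, hc, hc1, hcu, hcw, hsum⟩ := exists_twoStep_of_twoShell hP hu hu1 hw hw1 hne hadj hlt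
  refine ⟨c, hc, hc1, hcu, hcw, ?_⟩
  rw [hdu, hdw, inner_depthForm] at hsum
  linarith

/-! ## §3  The second-shell hook -/

/-- **CAP HOOK** (second shell): a developed second-shell label `w₂` (depth `≥ (9/10)s`) is adjacent to a unit `c ∈ P` of depth
`X(c) ≥ (14/25)·s`. [this file; HOOK `exists_hook_of_twoShell`, `hook_level`] -/
theorem capHook_second {P : Finset (EuclideanSpace ℝ (Fin 3))} (hP : P = fccTwoShellPattern ∨ P = hcpTwoShellPattern)
    {A : EuclideanSpace ℝ (Fin 3) →ₗ[ℝ] EuclideanSpace ℝ (Fin 3)} {Q : EuclideanSpace ℝ (Fin 3) →ₗᵢ[ℝ] EuclideanSpace ℝ (Fin 3)}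
    {τ s : ℝ} {Y w : EuclideanSpace ℝ (Fin 3)} (hτ : τ ≤ 1 / 20) (hA : ∀ v, ‖A v - Q v‖ ≤ τ * ‖v‖) (hs : 0 < s)
    (hsY : s ≤ ‖Y‖) (hw : w ∈ P) (hw2 : ‖w‖ ^ 2 = 2) (hwd : (9 / 10) * s ≤ -⟪Y, A w⟫) :
    ∃ c ∈ P, ‖c‖ = 1 ∧ dist c w = 1 ∧ (14 / 25) * s ≤ -⟪Y, A c⟫ := by
  set d : EuclideanSpace ℝ (Fin 3) := -(LinearMap.adjoint A Y) with hd
  have hdw : ⟪d, w⟫ = -⟪Y, A w⟫ := inner_depthForm A Y w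
  have hdn : (1 - τ) * ‖Y‖ ≤ ‖d‖ := by rw [hd, norm_neg]; exact norm_adjoint_ge hA Y
  have hdn' : (19 / 20) * s ≤ ‖d‖ := by nlinarith [norm_nonneg Y]
  obtain ⟨c, hc, hc1, hcw, h0, hsq⟩ := exists_hook_of_twoShell hP hw hw2 d
  refine ⟨c, hc, hc1, hcw, ?_⟩
  have hlow : -‖d‖ ≤ ⟪d, w⟫ := by rw [hdw]; linarith [norm_nonneg d]
  have hlev := hook_level hlow h0 hsq
  rw [hdw, inner_depthForm] at hlev
  rcases le_total (-⟪Y, A w⟫ / 2) (‖d‖ / 2) with h | h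
  · rw [min_eq_left h] at hlev; linarith
  · rw [min_eq_right h] at hlev; linarith

/-! ## §4  Labels of cap depth point to developed sites -/

/-- A unit label of depth `X(c) ≥ (14/25)·s` points to a site strictly nearer to the centre (fuzz `(2‖Y‖ + 3s)·δ₀ ≤ s²/100`).
[this file; Order `nearer_of_deep`] -/
theorem nearer_of_capDepth {A : EuclideanSpace ℝ (Fin 3) →ₗ[ℝ] EuclideanSpace ℝ (Fin 3)}
    {Q : EuclideanSpace ℝ (Fin 3) →ₗᵢ[ℝ] EuclideanSpace ℝ (Fin 3)} {τ s δ₀ : ℝ} {Y c z : EuclideanSpace ℝ (Fin 3)}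
    (hτ : τ ≤ 1 / 20) (hA : ∀ v, ‖A v - Q v‖ ≤ τ * ‖v‖) (hs : 0 < s) (hc1 : ‖c‖ = 1) (hcd : (14 / 25) * s ≤ -⟪Y, A c⟫) (hδ : 0 ≤ δ₀)
    (hz : ‖z - (Y + s • A c)‖ ≤ δ₀) (hfz : (2 * ‖Y‖ + 3 * s) * δ₀ ≤ s ^ 2 / 100) : ‖z‖ < ‖Y‖ := by
  refine nearer_of_deep hz ?_
  have hup : ‖s • A c‖ ≤ s * (21 / 20) := by
    rw [norm_smul, Real.norm_of_nonneg hs.le]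
    refine mul_le_mul_of_nonneg_left ?_ hs.le
    have := norm_frame_le hA c; rw [hc1] at this; linarith
  have hup2 : ‖s • A c‖ ^ 2 ≤ (s * (21 / 20)) ^ 2 := pow_le_pow_left₀ (norm_nonneg _) hup 2
  have hfuzz : (2 * ‖Y + s • A c‖ + δ₀) * δ₀ ≤ (2 * ‖Y‖ + 3 * s) * δ₀ := by
    apply mul_le_mul_of_nonneg_right _ hδ
    have hYw : ‖Y + s • A c‖ ≤ ‖Y‖ + s * (21 / 20) := (norm_add_le _ _).trans (add_le_add le_rfl hup)
    have : δ₀ ≤ s / 2 := by nlinarith [norm_nonneg Y]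
    linarith
  have hin : ⟪Y, s • A c⟫ = s * ⟪Y, A c⟫ := by rw [inner_smul_right]
  rw [hin]
  have hprod := mul_le_mul_of_nonneg_left hcd hs.le
  nlinarith

end Summit.AtomisticToContinuum.Crystallization.Theorems.OverbindingBudgetAffineFarSmoothSplit
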